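import Summits.Ventures.PercRepro.CoreFourCell
import Summits.Ventures.PercRepro.CoreFourClasses
import Summits.Ventures.PercRepro.CoreFourWeights

/-!
# PercRepro — the corank-`4` core cells `p = 9, 10` (p2, gen 12)

On the coloop-free core at corank `4` with `n = |E| ∈ {13, 14}` the bounds `s₃ ≤ 16`, `s₄ ≤ 35` of `CoreFourCell` are
too crude (ratios `1.19`, `1.07`). Let `S₀ = ⋃ {circuits with ≤ 4 elements}` and split on its nullity `ν(S₀) ≤ 4`:

* `ν(S₀) ≤ 3` (`rls_small_of_nullity_le_three`): all triangles lie in `S₀`, so `s₃ ≤ ν(S₀)² ≤ 9` (TriangleStar on `S₀`),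
  `s₄ ≤ 15` (the cocircuit count at nullity `≤ 3`: `U_{3,6}`), `D₅ ≤ 15·12` — ratios `0.97`, `0.89`;
* `ν(S₀) = 4` (`rls_small_of_dense`): then `S₀ = E` (full nullity, coloop-free), every element lies in a circuit with
  `≤ 4` elements, so every series class has `≤ 4` elements; with `σ, t₂, t₃, t₄` classes of sizes `1, 2, 3, 4`
  (`n = σ + 2t₂ + 3t₃ + 4t₄`, `c = σ + t₂ + t₃ + t₄` classes) the circuits with `3` / `4` elements are bounded BOTH by
  the cocircuit count with the exact `c` (`s·C(c − k − 1, 2) ≤ C(c, 3)`) AND by the class structure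
  (`CoreFourClasses` / `CoreFourWeights`: `s₃ ≤ C(σ,3) + σt₂ + t₃`, `s₄ ≤ C(σ,4) + C(σ,2)t₂ + C(t₂,2) + σt₃ + t₄`),
  `D₅ ≤ s₄(n − 4)`; every class-size vector passes by kernel evaluation (`table_dense_13`, `table_dense_14`; worst
  ratios `0.982` at `(σ,t₂,t₃,t₄) = (3,3,0,1)` for `n = 13`, `0.900` at `(2,6,0,0)` for `n = 14`).

* `ncard_isCircuit_four_le_of_nullity_le_three`, `…_of_subset_nullity_le_three` — `s₄ ≤ 15` at nullity `≤ 3`;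
* `sum_eq_of_le_four`, `card_eq_of_le_four` — the class-size bookkeeping; `lm`, `le_lm_of_mul_le` — the count as a bound;
* **`c025_core_four_small`** — the cells `p ∈ {9, 10}`; **`c025_core_four_all`** — every `9 ≤ p ≤ 17`;
* `SmallCoreCells''''`, `smallCoreCells'''_of`, **`c025_three_of_smallCoreCells''''`** — the q = 3 row from the cells
  without the corank-`4` cells `p ≤ 17`.
Imports `CoreFourCell`, `CoreFourClasses`, `CoreFourWeights`. Axioms: standard.
-/

namespace PercRepro
namespace CoreFour

open Set Finset

variable {α : Type} {M : Matroid α}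

/-! ### `s₄ ≤ 15` at nullity `≤ 3` -/

/-- **Four-element circuits at nullity `≤ 3`**: a finite matroid on at most `16` elements with `M✶.eRank ≤ 3` has at
most `15` four-element circuits (`15 = C(6, 2)`, `U_{3,6}`). -/
theorem ncard_isCircuit_four_le_of_nullity_le_three (M : Matroid α) [M.Finite]
    (hE : M.E.ncard ≤ 16) (hν : M✶.eRank ≤ 3) :
    {C | M.IsCircuit C ∧ C.ncard = 4}.ncard ≤ 15 := by
  obtain ⟨ν, hν3, hν'⟩ := PercRepro.Matroid.exists_nullity_eq_of_le M (n := 3) (by exact_mod_cast hν)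
  obtain ⟨c, hc, h⟩ := PercRepro.Matroid.exists_ncard_isCircuit_mul_choose_le M hν' 4
  have hc' : c ≤ 16 := hc.trans hE
  generalize {C | M.IsCircuit C ∧ C.ncard = 4}.ncard = s at h ⊢
  interval_cases ν <;> interval_cases c <;>
    norm_num [Nat.choose_eq_factorial_div_factorial, Nat.factorial, Nat.choose_two_right,
      Nat.choose_eq_zero_of_lt] at h ⊢ <;> omega

/-- The same for the `4`-circuits of `M` when they all lie in a set `S` with `|S| ≤ 16` and `|S| ≤ r(S) + 3`. -/
theorem ncard_isCircuit_four_le_of_subset_nullity_le_three (M : Matroid α) [M.Finite] {S : Set α}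
    (hS : S ⊆ M.E) (hcov : ∀ C, M.IsCircuit C → C.ncard = 4 → C ⊆ S) (hSc : S.ncard ≤ 16)
    (hν : S.encard ≤ M.eRk S + 3) : {C | M.IsCircuit C ∧ C.ncard = 4}.ncard ≤ 15 := by
  haveI : (M.restrict S).Finite := Matroid.restrict_finite (M.ground_finite.subset hS)
  rw [← PercRepro.Matroid.setOf_isCircuit_ncard_restrict_eq hS hcov]
  refine ncard_isCircuit_four_le_of_nullity_le_three (M.restrict S) ?_
    (PercRepro.Matroid.dual_eRank_restrict_le hS hν)
  rwa [Matroid.restrict_ground_eq]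

/-! ### Case A: `ν(S₀) ≤ 3` -/

/-- The cells `n = 13, 14` with `s₃ = 9`, `s₄ = 15`, `D₅ = 180`. -/
theorem table_sparse : ∀ n < 15, 13 ≤ n → cellOK4 n 9 15 180 = true := by
  decide +kernel

/-- **Case A**: on the coloop-free core at corank `4` with `|E| = p + 4`, `p ∈ {9, 10}`, if
`S₀ = ⋃ {circuits ≤ 4}` has nullity `≤ 3` then `RLS M p 3`. -/
theorem rls_small_of_nullity_le_three (M : Matroid α) [M.Finite] (p : ℕ) (hp : p = 9 ∨ p = 10)
    (hs : ∀ e ∈ M.E, ∀ f ∈ M.E, e ≠ f → M.eRk {e, f} = 2)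
    (hfree : ∀ e ∈ M.E, ∃ A ⊆ M.E \ {e}, e ∉ M.closure A ∧ e ∉ M.closure ((M.E \ {e}) \ A))
    (hcoloop : ∀ e, ¬ M.IsColoop e) (hrank : M.eRank = (p : ℕ∞)) (hE : M.E.ncard = p + 4)
    {d' : ℕ} (hd' : (⋃₀ PercRepro.Matroid.circuitsLE M 4).encard = M.eRk (⋃₀ PercRepro.Matroid.circuitsLE M 4) + d')
    (hd3 : d' ≤ 3) : ThmN.RLS M p 3 := by
  have hC1 : ∀ L ⊆ M.E, M.eRk L = 2 → L.ncard ≤ 3 :=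
    fun L hL hr => ThmN.ncard_le_three_of_eRk_two M hs hfree hL hr
  have hd : M.E.encard = M.eRank + 4 := by
    rw [hrank, ← M.ground_finite.cast_ncard_eq, hE]; push_cast; rfl
  have hS₀E : ⋃₀ PercRepro.Matroid.circuitsLE M 4 ⊆ M.E := sUnion_circuitsLE_subset_ground M 4
  have hS16 := ncard_sUnion_circuitsLE_four_le hd
  -- `s₃ ≤ d'² ≤ 9`
  have hs₃ : (PercRepro.Matroid.circuitsEq M 3).ncard ≤ 9 := by
    have h := ThmN.core_ncard_triangles_subset_le_sq M hs hfree hS₀E hd'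
    have hsub : PercRepro.Matroid.circuitsEq M 3 ⊆
        {C : Set α | M.IsCircuit C ∧ C.ncard = 3 ∧ C ⊆ ⋃₀ PercRepro.Matroid.circuitsLE M 4} := by
      intro C hC
      exact ⟨hC.1, hC.2, Set.subset_sUnion_of_mem (PercRepro.Matroid.circuitsEq_subset_circuitsLE (by norm_num) hC)⟩
    have hfin : {C : Set α | M.IsCircuit C ∧ C.ncard = 3 ∧ C ⊆ ⋃₀ PercRepro.Matroid.circuitsLE M 4}.Finite :=
      M.ground_finite.finite_subsets.subset (fun C hC => hC.1.subset_ground)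
    calc (PercRepro.Matroid.circuitsEq M 3).ncard ≤ _ := Set.ncard_le_ncard hsub hfin
      _ ≤ d' * d' := h
      _ ≤ 9 := Nat.mul_le_mul hd3 hd3
  -- `s₄ ≤ 15`
  have hs₄ : (PercRepro.Matroid.circuitsEq M 4).ncard ≤ 15 :=
    ncard_isCircuit_four_le_of_subset_nullity_le_three M hS₀E
      (fun C hC h4 => subset_sUnion_of_mem_circuitsEq_four ⟨hC, h4⟩) hS16
      (by rw [hd']; gcongr; exact_mod_cast hd3)
  have hD₅ : (PercRepro.Matroid.circuitsEq M 4).ncard * ((⋃₀ PercRepro.Matroid.circuitsLE M 4).ncard - 4) ≤ 180 := by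
    calc _ ≤ 15 * 12 := Nat.mul_le_mul hs₄ (by omega)
      _ = 180 := by norm_num
  exact rls_of_cellOK4 M p (by omega) hs hC1 hcoloop hrank hE hs₃ hs₄ hD₅
    (table_sparse (p + 4) (by omega) (by omega))

/-! ### Case B: `S₀ = E` -/

/-- `Σ_{r∈S} a r = σ + 2t₂ + 3t₃ + 4t₄` when `1 ≤ a ≤ 4` on `S`. -/
theorem sum_eq_of_le_four (S : Finset α) (a : α → ℕ) (h1 : ∀ r ∈ S, 1 ≤ a r) (h4 : ∀ r ∈ S, a r ≤ 4) :
    ∑ r ∈ S, a r = (S.filter (fun r => a r = 1)).card + 2 * (S.filter (fun r => a r = 2)).card +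
      3 * (S.filter (fun r => a r = 3)).card + 4 * (S.filter (fun r => a r = 4)).card := by
  classical
  have hmaps : ∀ r ∈ S, a r ∈ ({1, 2, 3, 4} : Finset ℕ) := by
    intro r hr
    have := h1 r hr; have := h4 r hr
    simp only [Finset.mem_insert, Finset.mem_singleton]; omega
  rw [← Finset.sum_fiberwise_of_maps_to hmaps a]
  have hfib : ∀ j, ∑ i ∈ S with a i = j, a i = j * (S.filter (fun r => a r = j)).card := by
    intro j
    rw [Finset.sum_congr rfl (fun i hi => (Finset.mem_filter.1 hi).2), Finset.sum_const, smul_eq_mul, mul_comm]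
  simp only [Finset.sum_insert (by decide : (1 : ℕ) ∉ ({2, 3, 4} : Finset ℕ)),
    Finset.sum_insert (by decide : (2 : ℕ) ∉ ({3, 4} : Finset ℕ)),
    Finset.sum_insert (by decide : (3 : ℕ) ∉ ({4} : Finset ℕ)), Finset.sum_singleton, hfib]
  ring

/-- `|S| = σ + t₂ + t₃ + t₄` when `1 ≤ a ≤ 4` on `S`. -/
theorem card_eq_of_le_four (S : Finset α) (a : α → ℕ) (h1 : ∀ r ∈ S, 1 ≤ a r) (h4 : ∀ r ∈ S, a r ≤ 4) :
    S.card = (S.filter (fun r => a r = 1)).card + (S.filter (fun r => a r = 2)).card +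
      (S.filter (fun r => a r = 3)).card + (S.filter (fun r => a r = 4)).card := by
  classical
  have hmaps : Set.MapsTo a (↑S : Set α) (↑({1, 2, 3, 4} : Finset ℕ) : Set ℕ) := by
    intro r hr
    have := h1 r hr; have := h4 r hr
    simp only [Finset.coe_insert, Finset.coe_singleton, Set.mem_insert_iff, Set.mem_singleton_iff]; omega
  rw [Finset.card_eq_sum_card_fiberwise hmaps]
  simp only [Finset.sum_insert (by decide : (1 : ℕ) ∉ ({2, 3, 4} : Finset ℕ)),
    Finset.sum_insert (by decide : (2 : ℕ) ∉ ({3, 4} : Finset ℕ)),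
    Finset.sum_insert (by decide : (3 : ℕ) ∉ ({4} : Finset ℕ)), Finset.sum_singleton]
  ring

/-- The cocircuit count of `RankLevelSetCocircuitCount` as an upper bound: at nullity `4`,
`#{k-circuits} ≤ C(c, 3) / C(c − k − 3 + 2, 2)` for `c` series classes. -/
def lm (c k : ℕ) : ℕ := c.choose 3 / (c - k - 3 + 2).choose 2

/-- The count `s · C(c − k − 1, 2) ≤ C(c, 3)` read as the bound `s ≤ lm c k`. -/
theorem le_lm_of_mul_le {s c k : ℕ} (h : s * (c - k - 3 + 2).choose 2 ≤ c.choose 3) : s ≤ lm c k := by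
  unfold lm
  rw [Nat.le_div_iff_mul_le (Nat.choose_pos (by omega))]
  exact h

/-- The bound on `s₃` from the class-size vector. -/
def bound3 (σ t₂ t₃ t₄ : ℕ) : ℕ := min (lm (σ + t₂ + t₃ + t₄) 3) (σ.choose 3 + σ * t₂ + t₃)

/-- The bound on `s₄` from the class-size vector. -/
def bound4 (σ t₂ t₃ t₄ : ℕ) : ℕ :=
  min (lm (σ + t₂ + t₃ + t₄) 4) (σ.choose 4 + σ.choose 2 * t₂ + t₂.choose 2 + σ * t₃ + t₄)

/-- Every class-size vector of the all-dense case at `n = 13` passes. -/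
theorem table_dense_13 : ∀ σ < 14, ∀ t₂ < 7, ∀ t₃ < 5, ∀ t₄ < 4, σ + 2 * t₂ + 3 * t₃ + 4 * t₄ = 13 →
    cellOK4 13 (bound3 σ t₂ t₃ t₄) (bound4 σ t₂ t₃ t₄) (bound4 σ t₂ t₃ t₄ * 9) = true := by
  decide +kernel

/-- Every class-size vector of the all-dense case at `n = 14` passes. -/
theorem table_dense_14 : ∀ σ < 15, ∀ t₂ < 8, ∀ t₃ < 5, ∀ t₄ < 4, σ + 2 * t₂ + 3 * t₃ + 4 * t₄ = 14 →
    cellOK4 14 (bound3 σ t₂ t₃ t₄) (bound4 σ t₂ t₃ t₄) (bound4 σ t₂ t₃ t₄ * 10) = true := by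
  decide +kernel

/-- **Case B**: on the coloop-free core at corank `4` with `|E| = p + 4`, `p ∈ {9, 10}`, if every element lies in a
circuit with `≤ 4` elements (`S₀ = E`) then `RLS M p 3`. -/
theorem rls_small_of_dense (M : Matroid α) [M.Finite] (p : ℕ) (hp : p = 9 ∨ p = 10)
    (hs : ∀ e ∈ M.E, ∀ f ∈ M.E, e ≠ f → M.eRk {e, f} = 2)
    (hC1 : ∀ L ⊆ M.E, M.eRk L = 2 → L.ncard ≤ 3) (hcoloop : ∀ e, ¬ M.IsColoop e)
    (hrank : M.eRank = (p : ℕ∞)) (hE : M.E.ncard = p + 4)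
    (hS₀ : ⋃₀ PercRepro.Matroid.circuitsLE M 4 = M.E) : ThmN.RLS M p 3 := by
  classical
  have hd : M.E.encard = M.eRank + 4 := by
    rw [hrank, ← M.ground_finite.cast_ncard_eq, hE]; push_cast; rfl
  -- the nullity of `M` is `4`
  have hν : M✶.eRank = 4 := by
    have h := Matroid.eRank_add_eRank_dual M
    rw [hd, hrank] at h
    exact WithTop.add_left_cancel (WithTop.natCast_ne_top p) h
  -- representatives of the series classes
  obtain ⟨R, hR⟩ := exists_isReps M
  have hRfin : R.Finite := M.ground_finite.subset hR.subset
  set Rf := hRfin.toFinset with hRf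
  set a : α → ℕ := fun r => (M✶.closure {r}).ncard with ha
  have hRc : R.ncard = Rf.card := Set.ncard_eq_toFinset_card _ _
  -- class sizes are between `1` and `4`
  have h1 : ∀ r ∈ Rf, 1 ≤ a r := by
    intro r hr
    rw [hRf, Set.Finite.mem_toFinset] at hr
    have hfin := cls_finite (M := M) r
    exact Nat.one_le_iff_ne_zero.2 (fun h0 => by
      have := (Set.ncard_eq_zero hfin).1 h0
      exact (Set.eq_empty_iff_forall_notMem.1 this r) (mem_cls_self hR hr))
  have h4 : ∀ r ∈ Rf, a r ≤ 4 := by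
    intro r hr
    rw [hRf, Set.Finite.mem_toFinset] at hr
    have hrE : r ∈ ⋃₀ PercRepro.Matroid.circuitsLE M 4 := by rw [hS₀]; exact hR.subset hr
    obtain ⟨C, hC, hrC⟩ := Set.mem_sUnion.1 hrE
    have hsub := closure_dual_singleton_subset_of_mem_isCircuit hcoloop hC.1 hrC
    have hCfin : C.Finite := M.ground_finite.subset hC.1.subset_ground
    have hC4 : C.ncard ≤ 4 := by
      have := hC.2
      rw [← hCfin.cast_ncard_eq] at this
      exact_mod_cast this
    exact (Set.ncard_le_ncard hsub hCfin).trans hC4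
  -- the class-size vector
  set σ := (Rf.filter (fun r => a r = 1)).card with hσ
  set t₂ := (Rf.filter (fun r => a r = 2)).card with ht₂
  set t₃ := (Rf.filter (fun r => a r = 3)).card with ht₃
  set t₄ := (Rf.filter (fun r => a r = 4)).card with ht₄
  have hn : p + 4 = σ + 2 * t₂ + 3 * t₃ + 4 * t₄ := by
    rw [← hE, ncard_ground_eq_sum hcoloop hR hRfin, ← hRf]
    exact sum_eq_of_le_four Rf a h1 h4
  have hc : Rf.card = σ + t₂ + t₃ + t₄ := card_eq_of_le_four Rf a h1 h4
  -- the cocircuit count with the exact number of classes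
  have hlm3 : (PercRepro.Matroid.circuitsEq M 3).ncard ≤ lm (σ + t₂ + t₃ + t₄) 3 := by
    have h := PercRepro.Matroid.ncard_isCircuit_mul_choose_le M hR.subset hR.nonloop hR.cover hR.inj hν 3
    rw [hRc, hc] at h
    exact le_lm_of_mul_le h
  have hlm4 : (PercRepro.Matroid.circuitsEq M 4).ncard ≤ lm (σ + t₂ + t₃ + t₄) 4 := by
    have h := PercRepro.Matroid.ncard_isCircuit_mul_choose_le M hR.subset hR.nonloop hR.cover hR.inj hν 4
    rw [hRc, hc] at h
    exact le_lm_of_mul_le h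
  -- the class-structure bounds
  have hw3 : (PercRepro.Matroid.circuitsEq M 3).ncard ≤ σ.choose 3 + σ * t₂ + t₃ :=
    (ncard_circuitsEq_le_card_weight hcoloop hR hRfin 3).trans (card_weight_three_le Rf a h1)
  have hw4 : (PercRepro.Matroid.circuitsEq M 4).ncard ≤
      σ.choose 4 + σ.choose 2 * t₂ + t₂.choose 2 + σ * t₃ + t₄ :=
    (ncard_circuitsEq_le_card_weight hcoloop hR hRfin 4).trans (card_weight_four_le Rf a h1)
  have hs₃ : (PercRepro.Matroid.circuitsEq M 3).ncard ≤ bound3 σ t₂ t₃ t₄ := le_min hlm3 hw3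
  have hs₄ : (PercRepro.Matroid.circuitsEq M 4).ncard ≤ bound4 σ t₂ t₃ t₄ := le_min hlm4 hw4
  have hD₅ : (PercRepro.Matroid.circuitsEq M 4).ncard * ((⋃₀ PercRepro.Matroid.circuitsLE M 4).ncard - 4) ≤
      bound4 σ t₂ t₃ t₄ * (p + 4 - 4) := by
    rw [hS₀, hE]
    exact Nat.mul_le_mul_right _ hs₄
  rcases hp with rfl | rfl
  · have hcell := table_dense_13 σ (by omega) t₂ (by omega) t₃ (by omega) t₄ (by omega) (by omega)
    exact rls_of_cellOK4 M 9 (by omega) hs hC1 hcoloop hrank hE hs₃ hs₄ hD₅ hcell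
  · have hcell := table_dense_14 σ (by omega) t₂ (by omega) t₃ (by omega) t₄ (by omega) (by omega)
    exact rls_of_cellOK4 M 10 (by omega) hs hC1 hcoloop hrank hE hs₃ hs₄ hD₅ hcell

/-! ### The cells `p = 9, 10`, and every `9 ≤ p ≤ 17` -/

/-- **C-025 at `(p, 3)` on the coloop-free core at corank `4` for `p ∈ {9, 10}`.** -/
theorem c025_core_four_small (M : Matroid α) [M.Finite] (p : ℕ) (hp : p = 9 ∨ p = 10)
    (hs : ∀ e ∈ M.E, ∀ f ∈ M.E, e ≠ f → M.eRk {e, f} = 2) (hcoloop : ∀ e, ¬ M.IsColoop e)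
    (hfree : ∀ e ∈ M.E, ∃ A ⊆ M.E \ {e}, e ∉ M.closure A ∧ e ∉ M.closure ((M.E \ {e}) \ A))
    (hrank : M.eRank = (p : ℕ∞)) (hE : M.E.ncard = p + 4) : ThmN.RLS M p 3 := by
  have hC1 : ∀ L ⊆ M.E, M.eRk L = 2 → L.ncard ≤ 3 :=
    fun L hL hr => ThmN.ncard_le_three_of_eRk_two M hs hfree hL hr
  have hd : M.E.encard = M.eRank + 4 := by
    rw [hrank, ← M.ground_finite.cast_ncard_eq, hE]; push_cast; rfl
  set S₀ := ⋃₀ PercRepro.Matroid.circuitsLE M 4 with hS₀def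
  have hS₀E : S₀ ⊆ M.E := sUnion_circuitsLE_subset_ground M 4
  have hS₀fin : S₀.Finite := M.ground_finite.subset hS₀E
  -- the nullity of `S₀`
  obtain ⟨r, hr⟩ := exists_eRk_eq_nat (M := M) S₀
  have hrle : r ≤ S₀.ncard := by
    have := M.eRk_le_encard S₀
    rw [hr, ← hS₀fin.cast_ncard_eq] at this
    exact_mod_cast this
  have hd' : S₀.encard = M.eRk S₀ + ((S₀.ncard - r : ℕ) : ℕ∞) := by
    rw [hr, ← hS₀fin.cast_ncard_eq]
    have : S₀.ncard = r + (S₀.ncard - r) := by omega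
    conv_lhs => rw [this]
    push_cast; rfl
  have hmono := encard_le_eRk_add_of_ground hS₀E hd
  rw [hd'] at hmono
  have hle4 : S₀.ncard - r ≤ 4 := by
    have h := (WithTop.add_le_add_iff_left (by rw [hr]; exact WithTop.natCast_ne_top r)).1 hmono
    have h' : ((S₀.ncard - r : ℕ) : ℕ∞) ≤ ((4 : ℕ) : ℕ∞) := h
    exact_mod_cast h'
  rcases Nat.lt_or_ge (S₀.ncard - r) 4 with hlt | hge
  · exact rls_small_of_nullity_le_three M p hp hs hfree hcoloop hrank hE hd' (by omega)
  · have h4 : S₀.ncard - r = 4 := by omega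
    rw [h4] at hd'
    have hS₀ : S₀ = M.E := eq_ground_of_encard_eq_eRk_add hcoloop hS₀E hd hd'
    exact rls_small_of_dense M p hp hs hC1 hcoloop hrank hE hS₀

/-- **C-025 at `(p, 3)` on the coloop-free core at corank `4` for every `9 ≤ p ≤ 17`.** -/
theorem c025_core_four_all (M : Matroid α) [M.Finite] (p : ℕ) (hp : 9 ≤ p) (hp' : p ≤ 17)
    (hs : ∀ e ∈ M.E, ∀ f ∈ M.E, e ≠ f → M.eRk {e, f} = 2) (hcoloop : ∀ e, ¬ M.IsColoop e)
    (hfree : ∀ e ∈ M.E, ∃ A ⊆ M.E \ {e}, e ∉ M.closure A ∧ e ∉ M.closure ((M.E \ {e}) \ A))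
    (hrank : M.eRank = (p : ℕ∞)) (hE : M.E.ncard = p + 4) : ThmN.RLS M p 3 := by
  rcases Nat.lt_or_ge p 11 with hlt | hge
  · exact c025_core_four_small M p (by omega) hs hcoloop hfree hrank hE
  · exact c025_core_four M p hge hp' hs hcoloop hfree hrank hE

/-- **The small core cells without any corank-`4` cell below `p = 18`**: `p ∈ {7, 8}`, or `9 ≤ p ≤ 169` with
`p + 4 ≤ |E| < p + amin p`, corank `4` only for `p ≤ 8` (vacuous for the wrapper) and `18 ≤ p ≤ 95`. -/
def SmallCoreCells'''' : Prop :=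
  ∀ {α : Type} (M : Matroid α) [M.Finite] (p : ℕ), 5 ≤ p →
    (∀ e ∈ M.E, ∀ f ∈ M.E, e ≠ f → M.eRk {e, f} = 2) → M.eRank = (p : ℕ∞) →
    (∀ e, ¬ M.IsColoop e) →
    (∀ e ∈ M.E, ∃ A ⊆ M.E \ {e}, e ∉ M.closure A ∧ e ∉ M.closure ((M.E \ {e}) \ A)) →
    ((p = 7 ∨ p = 8) ∨
      (p ≤ 169 ∧ p + 4 ≤ M.E.ncard ∧ M.E.ncard < p + CoreRegimes.amin p ∧
        ¬ (M.E.ncard = p + 4 ∧ 100 ≤ M.E.ncard) ∧ ¬ (M.E.ncard = p + 4 ∧ 9 ≤ p ∧ p ≤ 17))) →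
    ThmN.RLS M p 3

/-- The cells of `SmallCoreCells'''` outside `SmallCoreCells''''` are the corank-`4` cells `9 ≤ p ≤ 10`. -/
theorem smallCoreCells'''_of (h : SmallCoreCells'''') : SmallCoreCells''' := by
  intro α M _ p hp hs hrank hcoloop hfree hcell
  rcases hcell with h78 | ⟨hp169, hlo, hhi, h4, hmid⟩
  · exact h M p hp hs hrank hcoloop hfree (Or.inl h78)
  · by_cases hsmall : M.E.ncard = p + 4 ∧ 9 ≤ p ∧ p ≤ 17
    · exact c025_core_four_all M p hsmall.2.1 hsmall.2.2 hs hcoloop hfree hrank hsmall.1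
    · exact h M p hp hs hrank hcoloop hfree (Or.inr ⟨hp169, hlo, hhi, h4, hsmall⟩)

/-- **C-025 at `q = 3` for every finite matroid and every `p ≥ 5`, from the cells without corank `4` below `p = 18`.** -/
theorem c025_three_of_smallCoreCells'''' (h : SmallCoreCells'''') :
    ∀ {α : Type} (M : Matroid α) [M.Finite] (p : ℕ), 5 ≤ p → ThmN.RLS M p 3 :=
  c025_three_of_smallCoreCells''' (smallCoreCells'''_of h)

end CoreFour
end PercRepro
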